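import Literature.NumberTheory.LocalFields.RestrictedPowerSeriesStrictDifferentiability
import Literature.NumberTheory.LocalFields.RestrictedPowerSeriesInverse
import Literature.NumberTheory.LocalFields.BoundedPowerSeriesZeros
import Mathlib.NumberTheory.Padics.PadicNumbers
import Mathlib.Analysis.Normed.Algebra.Ultra
import Mathlib.Tactic
import HarnessLib

/-!
# Two bounded `p`-adic power series whose values along the nodes `uᵗ − 1` are proportional by
# `c·dᵗ` satisfy `(1+X)(f·g′ − g·f′) = e·f·g` — they differ by a binomial twist `(1+X)^e`
# (Robert, *A Course in p-adic Analysis*, Ch. V §2.4 Theorem 1; Gouvêa, *p-adic Numbers*, §5.9)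

Topic `NumberTheory/LocalFields`; namespace `Literature.NumberTheory.LocalFields`. Everything here is
proved (theorems only; no definitions, no named facts). `K` is a complete (ultrametric) normed field
which is a normed `ℚ_p`-algebra (`ℚ_p`, its finite extensions, `ℂ_p`); `f(x) = ∑' n, coeff n f * x ^ n`.

SETTING. `f, g ∈ K⟦X⟧` with coefficients of norm `≤ 1` (Iwasawa functions), `u` a one-unit
(`‖u − 1‖ < 1`) which is not a root of unity, so that the NODES `y_t = uᵗ − 1` (`t ∈ ℕ`) are
infinitely many points of the closed disc `‖x‖ ≤ ‖u − 1‖ < 1`, and `c, d ∈ Kˣ` with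
`g(y_t) = c · dᵗ · f(y_t)` for every `t ∈ ℕ` and ONE `f(y_{t₀}) ≠ 0`. (This is the shape in which the
values of two `p`-adic measures on a `ℤ_p`-line — e.g. two Katz–de Shalit frames at different period
data — compare at the interpolation characters.)

THEOREM (`exists_wronskian_eq_of_node_values`): there is `e ∈ K` with
`(1 + X)·(f·g′ − g·f′) = e·f·g` in `K⟦X⟧` — the division-free form of "`g/f = c'·(1+X)^e`"
(`BinomialSeriesDifferentialEquation.exists_ode_of_wronskian` then gives `g = Q·f` with
`(1+X)Q′ = eQ`, and `BinomialTwistExponentPadicIntegral.exists_padicInt_eq_of_binomial_twist'` gives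
`e ∈ ℤ_p` when `f, g` have unit content). Moreover `e = lim_k (d^{p^k} − 1)/(u^{p^k} − 1)`
(`tendsto_div_of_node_values`).

PROOF (difference quotients along `t ↦ t + p^k`; no logarithms). With `ε_k = u^{p^k} − 1 → 0`
(`‖u^{p^{k+1}} − 1‖ ≤ max(‖p‖, ‖u^{p^k} − 1‖)·‖u^{p^k} − 1‖`) one has `y_{t+p^k} = y_t + uᵗε_k`, and the
exact identity `f(y_t)(g(y_{t+p^k}) − g(y_t)) − g(y_t)(f(y_{t+p^k}) − f(y_t)) = (d^{p^k} − 1)·g(y_t)·f(y_{t+p^k})`.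
Dividing by `uᵗε_k` and letting `k → ∞`, the difference quotients tend to the derivatives
(Robert V.2.4 Theorem 1: restricted series are strictly differentiable, with the estimate
`|Φf(x,y) − f′(ξ)| ≤ ‖f‖·max(|x−ξ|,|y−ξ|)`, applied after rescaling `X ↦ πX`, `π = u − 1`); at
`t = t₀` this shows that `(d^{p^k} − 1)/ε_k` converges, to `e` say, and then for every `t`:
`(1 + y_t)(f(y_t)g′(y_t) − g(y_t)f′(y_t)) = e·f(y_t)g(y_t)`. The bounded series
`(1+X)(fg′ − gf′) − e·fg` thus vanishes at all nodes, hence is `0` (Strassmann on the closed disc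
`‖x‖ ≤ ‖u − 1‖`, `eq_zero_of_infinite_zeros_closedBall`).

## References

* A. M. Robert, *A Course in p-adic Analysis*, GTM 198, Springer 2000, Ch. V §2.4 Theorem 1 (held
  text pp. 0316–0317); Ch. VI §2.1 (Strassman). [Robert2000PadicAnalysis]
* F. Q. Gouvêa, *p-adic Numbers: An Introduction*, Universitext, Springer 1993, §5.9 (the binomial
  series `(1+x)^α = B(α,x)`), Problem 194. [Gouvea1993PadicNumbers]
-/

noncomputable section

open Finset Filter Topology PowerSeries

namespace Literature.NumberTheory.LocalFields

variable {p : ℕ} {K : Type*} [NontriviallyNormedField K] [IsUltrametricDist K]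

/-! ## §0. One-units: `u^{p^k} → 1` -/

section OneUnits

omit [IsUltrametricDist K] in
/-- `‖p‖ < 1` in a normed `ℚ_p`-algebra. [folklore] -/
private theorem btn_norm_p_lt_one [Fact p.Prime] [NormedAlgebra ℚ_[p] K] : ‖(p : K)‖ < 1 := by
  rw [← map_natCast (algebraMap ℚ_[p] K) p, norm_algebraMap', Padic.norm_p]
  exact inv_lt_one_of_one_lt₀ (by exact_mod_cast (Fact.out : p.Prime).one_lt)

omit [IsUltrametricDist K] in
/-- `‖n‖ ≤ 1` for natural numbers in a normed `ℚ_p`-algebra. [folklore] -/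
private theorem btn_norm_natCast_le_one [Fact p.Prime] [NormedAlgebra ℚ_[p] K] (n : ℕ) :
    ‖(n : K)‖ ≤ 1 := by
  rw [← map_natCast (algebraMap ℚ_[p] K) n, norm_algebraMap']
  exact_mod_cast Padic.norm_int_le_one (p := p) n

/-- A one-unit has norm `1`. [folklore] -/
private theorem btn_norm_eq_one_of_oneUnit {u : K} (hu : ‖u - 1‖ < 1) : ‖u‖ = 1 := by
  have h := IsUltrametricDist.norm_add_eq_max_of_norm_ne_norm (x := u - 1) (y := (1 : K))
    (by rw [norm_one]; exact hu.ne)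
  rw [sub_add_cancel, norm_one] at h
  rw [h]; exact max_eq_right hu.le

/-- `‖uᵐ − 1‖ ≤ ‖u − 1‖` for a one-unit `u`. [folklore] -/
private theorem btn_norm_pow_sub_one_le {u : K} (hu : ‖u - 1‖ < 1) (m : ℕ) :
    ‖u ^ m - 1‖ ≤ ‖u - 1‖ := by
  have hu1 := btn_norm_eq_one_of_oneUnit hu
  rw [← geom_sum_mul, norm_mul]
  refine mul_le_of_le_one_left (norm_nonneg _) ?_
  refine IsUltrametricDist.norm_sum_le_of_forall_le_of_nonneg zero_le_one fun i _ ↦ ?_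
  rw [norm_pow, hu1, one_pow]

/-- **One `p`-th power contracts a one-unit towards `1`**:
`‖uᵖ − 1‖ ≤ max(‖p‖, ‖u − 1‖)·‖u − 1‖`. [cite: Gouvea1993PadicNumbers, §5.7 Lemma 5.7.4 / Prop. 5.7.8 (proof)] -/
theorem norm_pow_prime_sub_one_le_max_mul {u : K} (hu : ‖u - 1‖ < 1) :
    ‖u ^ p - 1‖ ≤ max ‖(p : K)‖ ‖u - 1‖ * ‖u - 1‖ := by
  have hS : ‖∑ j ∈ range p, u ^ j‖ ≤ max ‖(p : K)‖ ‖u - 1‖ := by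
    have hsplit : ∑ j ∈ range p, u ^ j = (p : K) + ∑ j ∈ range p, (u ^ j - 1) := by
      rw [sum_sub_distrib, sum_const, card_range, nsmul_eq_mul, mul_one]; ring
    rw [hsplit]
    refine (IsUltrametricDist.norm_add_le_max _ _).trans (max_le_max le_rfl ?_)
    exact IsUltrametricDist.norm_sum_le_of_forall_le_of_nonneg (norm_nonneg _)
      fun j _ ↦ btn_norm_pow_sub_one_le hu j
  rw [← geom_sum_mul, norm_mul]
  exact mul_le_mul_of_nonneg_right hS (norm_nonneg _)

/-- **`‖u^{p^k} − 1‖ ≤ θ^k·‖u − 1‖` with `θ = max(‖p‖, ‖u − 1‖) < 1`**: `u^{p^k} → 1` for a one-unit.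
[cite: Gouvea1993PadicNumbers, §5.7 Prop. 5.7.8 (proof)] -/
theorem norm_pow_prime_pow_sub_one_le_pow_mul [Fact p.Prime] [NormedAlgebra ℚ_[p] K] {u : K}
    (hu : ‖u - 1‖ < 1) (k : ℕ) :
    ‖u ^ p ^ k - 1‖ ≤ (max ‖(p : K)‖ ‖u - 1‖) ^ k * ‖u - 1‖ := by
  set θ : ℝ := max ‖(p : K)‖ ‖u - 1‖ with hθ
  have hθ0 : 0 ≤ θ := le_max_of_le_right (norm_nonneg _)
  have hθ1 : θ ≤ 1 := max_le (btn_norm_p_lt_one (p := p)).le hu.le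
  induction k with
  | zero => simp
  | succ k ih =>
    have hzle : ‖u ^ p ^ k - 1‖ ≤ ‖u - 1‖ := ih.trans
      ((mul_le_mul_of_nonneg_right (pow_le_one₀ hθ0 hθ1) (norm_nonneg _)).trans (one_mul _).le)
    have hz : ‖u ^ p ^ k - 1‖ < 1 := lt_of_le_of_lt hzle hu
    rw [pow_succ, pow_mul]
    calc ‖(u ^ p ^ k) ^ p - 1‖ ≤ max ‖(p : K)‖ ‖u ^ p ^ k - 1‖ * ‖u ^ p ^ k - 1‖ :=
          norm_pow_prime_sub_one_le_max_mul (p := p) hz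
      _ ≤ θ * (θ ^ k * ‖u - 1‖) := mul_le_mul (max_le_max le_rfl hzle) ih (norm_nonneg _) hθ0
      _ = θ ^ (k + 1) * ‖u - 1‖ := by ring

/-- `u^{p^k} − 1 → 0` for a one-unit `u`. [cite: Gouvea1993PadicNumbers, §5.7 Prop. 5.7.8 (proof)] -/
theorem tendsto_pow_prime_pow_sub_one [Fact p.Prime] [NormedAlgebra ℚ_[p] K] {u : K}
    (hu : ‖u - 1‖ < 1) : Tendsto (fun k : ℕ ↦ u ^ p ^ k - 1) atTop (𝓝 0) := by
  have hθ0 : 0 ≤ max ‖(p : K)‖ ‖u - 1‖ := le_max_of_le_right (norm_nonneg _)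
  have hθ1 : max ‖(p : K)‖ ‖u - 1‖ < 1 := max_lt (btn_norm_p_lt_one (p := p)) hu
  refine squeeze_zero_norm (fun k ↦ norm_pow_prime_pow_sub_one_le_pow_mul (p := p) hu k) ?_
  simpa using (tendsto_pow_atTop_nhds_zero_of_lt_one hθ0 hθ1).mul_const ‖u - 1‖

end OneUnits

/-! ## §1. Bounded series on a closed sub-disc: evaluation is a ring homomorphism -/

section Eval

variable [CompleteSpace K]

omit [CompleteSpace K] in
/-- Coefficientwise bounds are stable under products (ultrametric). [folklore] -/
private theorem btn_bdd_mul {f g : K⟦X⟧} {A B : ℝ} (hA : 0 ≤ A) (hf : ∀ n, ‖coeff n f‖ ≤ A)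
    (hg : ∀ n, ‖coeff n g‖ ≤ B) (n : ℕ) : ‖coeff n (f * g)‖ ≤ A * B := by
  have hB : 0 ≤ B := (norm_nonneg _).trans (hg 0)
  rw [coeff_mul]
  refine IsUltrametricDist.norm_sum_le_of_forall_le_of_nonneg (mul_nonneg hA hB) fun ij _ ↦ ?_
  rw [norm_mul]
  exact mul_le_mul (hf _) (hg _) (norm_nonneg _) hA

omit [CompleteSpace K] in
/-- Coefficientwise bounds are stable under differences (ultrametric). [folklore] -/
private theorem btn_bdd_sub {f g : K⟦X⟧} {A B : ℝ} (hf : ∀ n, ‖coeff n f‖ ≤ A)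
    (hg : ∀ n, ‖coeff n g‖ ≤ B) (n : ℕ) : ‖coeff n (f - g)‖ ≤ max A B := by
  rw [map_sub, sub_eq_add_neg]
  exact (IsUltrametricDist.norm_add_le_max _ _).trans
    (max_le_max (hf n) (by rw [norm_neg]; exact hg n))

omit [IsUltrametricDist K] [CompleteSpace K] in
/-- `‖[Xⁿ](C e · f)‖ ≤ ‖e‖·A`. [folklore] -/
private theorem btn_bdd_C_mul {f : K⟦X⟧} {A : ℝ} (hf : ∀ n, ‖coeff n f‖ ≤ A) (e : K) (n : ℕ) :
    ‖coeff n (C e * f)‖ ≤ ‖e‖ * A := by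
  rw [coeff_C_mul, norm_mul]; exact mul_le_mul_of_nonneg_left (hf n) (norm_nonneg _)

omit [CompleteSpace K] in
/-- `‖[Xⁿ]((1 + X)·f)‖ ≤ A`. [folklore] -/
private theorem btn_bdd_one_add_X_mul {f : K⟦X⟧} {A : ℝ} (hf : ∀ n, ‖coeff n f‖ ≤ A) (n : ℕ) :
    ‖coeff n ((1 + X) * f)‖ ≤ A := by
  rw [add_mul, one_mul, map_add]
  refine (IsUltrametricDist.norm_add_le_max _ _).trans (max_le (hf n) ?_)
  cases n with
  | zero => rw [coeff_zero_X_mul, norm_zero]; exact (norm_nonneg _).trans (hf 0)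
  | succ n => rw [coeff_succ_X_mul]; exact hf n

omit [IsUltrametricDist K] [CompleteSpace K] in
/-- The derivative of a series with coefficients of norm `≤ A` has coefficients of norm `≤ A` (the
integers have norm `≤ 1`). [folklore] -/
private theorem btn_bdd_derivative [Fact p.Prime] [NormedAlgebra ℚ_[p] K] {f : K⟦X⟧} {A : ℝ}
    (hf : ∀ n, ‖coeff n f‖ ≤ A) (n : ℕ) : ‖coeff n (derivative K f)‖ ≤ A := by
  rw [coeff_derivative, norm_mul]
  have h1 : ‖((n : K) + 1)‖ ≤ 1 := by exact_mod_cast btn_norm_natCast_le_one (p := p) (K := K) (n + 1)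
  exact (mul_le_mul_of_nonneg_left h1 (norm_nonneg _)).trans (by rw [mul_one]; exact hf _)

omit [IsUltrametricDist K] [CompleteSpace K] in
/-- Evaluation of `C e · f` at a point of the sub-disc. [folklore] -/
private theorem btn_tsum_C_mul (f : K⟦X⟧) (e x : K) :
    ∑' n, coeff n (C e * f) * x ^ n = e * ∑' n, coeff n f * x ^ n := by
  rw [← tsum_mul_left]; exact tsum_congr fun n ↦ by rw [coeff_C_mul, mul_assoc]

/-- Evaluation of `(1 + X)·f`: `((1+X)f)(x) = (1 + x)·f(x)` on the sub-disc `‖x‖ ≤ c < 1` for a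
bounded `f`. [folklore] -/
private theorem btn_tsum_one_add_X_mul {f : K⟦X⟧} {A : ℝ} (hf : ∀ n, ‖coeff n f‖ ≤ A) {c : ℝ}
    (hc0 : 0 ≤ c) (hc1 : c < 1) {x : K} (hx : ‖x‖ ≤ c) :
    ∑' n, coeff n ((1 + X) * f) * x ^ n = (1 + x) * ∑' n, coeff n f * x ^ n := by
  have hX : (X : K⟦X⟧) = monomial 1 (1 : K) := by
    ext n; simp [coeff_X, coeff_monomial]
  have h1X : IsRestricted c (1 + X : K⟦X⟧) :=
    IsRestricted.add c (IsRestricted.one c) (by rw [hX]; exact IsRestricted.monomial c 1 (1 : K))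
  rw [tsum_coeff_mul h1X (isRestricted_of_norm_coeff_le hf hc0 hc1) hx]
  congr 1
  have h2 : ∀ n, coeff n (1 + X : K⟦X⟧) * x ^ n = if n = 0 then 1 else if n = 1 then x else 0 := by
    intro n
    rw [map_add, coeff_one, coeff_X]
    rcases Nat.lt_trichotomy n 1 with hn | hn | hn
    · have : n = 0 := by omega
      subst this; simp
    · subst hn; simp
    · rw [if_neg (by omega), if_neg (by omega), if_neg (by omega), if_neg (by omega)]; ring
  rw [tsum_congr h2, tsum_eq_sum (s := {0, 1}) (fun n hn ↦ by
    simp only [Finset.mem_insert, Finset.mem_singleton, not_or] at hn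
    rw [if_neg hn.1, if_neg hn.2])]
  simp

end Eval

/-! ## §2. The difference-quotient estimate on a closed sub-disc (Robert V.2.4 Theorem 1, rescaled) -/

section Slope

variable [CompleteSpace K]

omit [IsUltrametricDist K] [CompleteSpace K] in
/-- Rescaled evaluation: `f(x) = f̃(x/π)` with `f̃ = rescale π f`. [folklore] -/
private theorem btn_tsum_rescale (f : K⟦X⟧) {π : K} (hπ : π ≠ 0) (x : K) :
    ∑' n, coeff n (rescale π f) * (x / π) ^ n = ∑' n, coeff n f * x ^ n :=
  tsum_congr fun n ↦ by
    rw [coeff_rescale, div_pow]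
    field_simp

omit [IsUltrametricDist K] [CompleteSpace K] in
/-- Rescaled derivative: `f̃′(x/π) = π·f′(x)`. [folklore] -/
private theorem btn_tsum_derivative_rescale (f : K⟦X⟧) {π : K} (hπ : π ≠ 0) (x : K) :
    ∑' n, coeff n (derivative K (rescale π f)) * (x / π) ^ n =
      π * ∑' n, coeff n (derivative K f) * x ^ n := by
  rw [← tsum_mul_left]
  refine tsum_congr fun n ↦ ?_
  rw [coeff_derivative, coeff_derivative, coeff_rescale, div_pow, pow_succ]
  field_simp

/-- **The estimate of Robert V.2.4 Theorem 1 on the closed disc `‖x‖ ≤ ‖π‖ < 1` for a series with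
coefficients of norm `≤ 1`**: `‖(f(y+h) − f(y))/h − f′(y)‖ ≤ ‖h‖/‖π‖²` for `y, y + h` in the disc,
`h ≠ 0` (apply the theorem to `f̃ = f(πX) ∈ K{X}`, `‖f̃‖ ≤ 1`).
[cite: Robert2000PadicAnalysis, Ch. V §2.4 Theorem 1] -/
theorem norm_slope_sub_derivative_le_of_norm_coeff_le_one {f : K⟦X⟧} (hf : ∀ n, ‖coeff n f‖ ≤ 1)
    {π y h : K} (hπ0 : π ≠ 0) (hπ1 : ‖π‖ < 1) (hy : ‖y‖ ≤ ‖π‖) (hyh : ‖y + h‖ ≤ ‖π‖) (hh : h ≠ 0) :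
    ‖h⁻¹ * (∑' n, coeff n f * (y + h) ^ n - ∑' n, coeff n f * y ^ n) -
        ∑' n, coeff n (derivative K f) * y ^ n‖ ≤ ‖h‖ / ‖π‖ ^ 2 := by
  have hπ : 0 < ‖π‖ := norm_pos_iff.2 hπ0
  set ft : K⟦X⟧ := rescale π f with hft
  -- `f̃ ∈ K{X}` with `‖f̃‖ ≤ 1`
  have hcoef : ∀ n, ‖coeff n ft‖ ≤ ‖π‖ ^ n := fun n ↦ by
    rw [hft, coeff_rescale, norm_mul, norm_pow]
    exact mul_le_of_le_one_right (pow_nonneg (norm_nonneg _) _) (hf n)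
  have hres : IsRestricted 1 ft := by
    refine squeeze_zero (fun n ↦ mul_nonneg (norm_nonneg _) (pow_nonneg zero_le_one _)) (fun n ↦ ?_)
      (tendsto_pow_atTop_nhds_zero_of_lt_one (norm_nonneg π) hπ1)
    rw [one_pow, mul_one]; exact hcoef n
  have hgauss : gaussNorm norm 1 ft ≤ 1 := by
    rw [gaussNorm_eq]
    refine ciSup_le fun n ↦ ?_
    rw [one_pow, mul_one]
    exact (hcoef n).trans (pow_le_one₀ (norm_nonneg _) hπ1.le)
  -- the points `ỹ = y/π`, `x̃ = (y+h)/π` of the unit ball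
  have hyt : ‖y / π‖ ≤ 1 := by rw [norm_div, div_le_one hπ]; exact hy
  have hxt : ‖(y + h) / π‖ ≤ 1 := by rw [norm_div, div_le_one hπ]; exact hyh
  have hne : (y + h) / π ≠ y / π := by
    intro heq; apply hh
    have := congrArg (· * π) heq
    simp only [div_mul_cancel₀ _ hπ0] at this
    linear_combination this
  have hest := norm_slope_sub_tsum_derivative_le hres hxt hyt hyt hne
  rw [sub_self, norm_zero, max_eq_left (norm_nonneg _), btn_tsum_rescale f hπ0,
    btn_tsum_rescale f hπ0, btn_tsum_derivative_rescale f hπ0,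
    show (y + h) / π - y / π = h / π by ring] at hest
  -- `hest : ‖(h/π)⁻¹·(f(y+h) − f(y)) − π·f′(y)‖ ≤ ‖f̃‖·‖h/π‖`
  have hkey : (h / π)⁻¹ * (∑' n, coeff n f * (y + h) ^ n - ∑' n, coeff n f * y ^ n) -
      π * ∑' n, coeff n (derivative K f) * y ^ n =
      π * (h⁻¹ * (∑' n, coeff n f * (y + h) ^ n - ∑' n, coeff n f * y ^ n) -
        ∑' n, coeff n (derivative K f) * y ^ n) := by
    rw [inv_div]; field_simp
  rw [hkey, norm_mul] at hest
  rw [le_div_iff₀ (pow_pos hπ 2)]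
  calc _ = ‖π‖ * ‖h⁻¹ * (∑' n, coeff n f * (y + h) ^ n - ∑' n, coeff n f * y ^ n) -
        ∑' n, coeff n (derivative K f) * y ^ n‖ * ‖π‖ := by ring
    _ ≤ gaussNorm norm 1 ft * ‖h / π‖ * ‖π‖ := mul_le_mul_of_nonneg_right hest (norm_nonneg _)
    _ ≤ 1 * ‖h / π‖ * ‖π‖ :=
        mul_le_mul_of_nonneg_right (mul_le_mul_of_nonneg_right hgauss (norm_nonneg _)) (norm_nonneg _)
    _ = ‖h‖ := by rw [one_mul, norm_div, div_mul_cancel₀ _ hπ.ne']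

end Slope

/-! ## §3. The theorem -/

section Main

/-- The nodes `uᵗ − 1` of a one-unit `u` that is not a root of unity are pairwise distinct. [folklore] -/
private theorem btn_nodes_injective {u : K} (hu : ‖u - 1‖ < 1) (hroot : ∀ n : ℕ, 0 < n → u ^ n ≠ 1) :
    Function.Injective fun t : ℕ ↦ u ^ t - 1 := by
  have hu0 : u ≠ 0 := fun h ↦ by
    have := btn_norm_eq_one_of_oneUnit hu; rw [h, norm_zero] at this; exact zero_ne_one this
  have hkey : ∀ s n : ℕ, 0 < n → u ^ s ≠ u ^ (s + n) := by
    intro s n hn h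
    refine hroot n hn (mul_left_cancel₀ (pow_ne_zero s hu0) ?_)
    rw [mul_one, ← pow_add]; exact h.symm
  intro s s' h
  have h' : u ^ s = u ^ s' := sub_left_injective h
  by_contra hne
  rcases Nat.lt_or_gt_of_ne hne with hlt | hlt
  · have h2 := hkey s (s' - s) (Nat.sub_pos_of_lt hlt)
    rw [Nat.add_sub_cancel' hlt.le] at h2
    exact h2 h'
  · have h2 := hkey s' (s - s') (Nat.sub_pos_of_lt hlt)
    rw [Nat.add_sub_cancel' hlt.le] at h2
    exact h2 h'.symm

variable [hp : Fact p.Prime] [instK : NormedAlgebra ℚ_[p] K] [CompleteSpace K]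
include hp instK

/-- **Proportional node values force a binomial twist (Wronskian form).** Let `f, g ∈ K⟦X⟧` have
coefficients of norm `≤ 1`, `u` a one-unit which is not a root of unity, `c, d ≠ 0`, and suppose
`g(uᵗ − 1) = c·dᵗ·f(uᵗ − 1)` for every `t ∈ ℕ` and `f(u^{t₀} − 1) ≠ 0` for one `t₀`. Then there is
`e ∈ K` with `(1 + X)·(f·g′ − g·f′) = e·(f·g)` — `g/f` satisfies the differential equation of
`(1+X)^e` (Gouvêa §5.9), i.e. `g = c'·(1+X)^e·f`. Proof: Robert's strict differentiability of
restricted series along the increments `t ↦ t + p^k`, then Strassmann.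
[cite: Robert2000PadicAnalysis, Ch. V §2.4 Theorem 1; Ch. VI §2.1 Theorem (Strassman)] -/
theorem exists_wronskian_eq_of_node_values {f g : K⟦X⟧} (hf : ∀ n, ‖coeff n f‖ ≤ 1)
    (hg : ∀ n, ‖coeff n g‖ ≤ 1) {u c d : K} (hu : ‖u - 1‖ < 1) (hroot : ∀ n : ℕ, 0 < n → u ^ n ≠ 1)
    (hc : c ≠ 0) (hd : d ≠ 0)
    (hrel : ∀ t : ℕ, ∑' n, coeff n g * (u ^ t - 1) ^ n = c * d ^ t * ∑' n, coeff n f * (u ^ t - 1) ^ n)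
    {t₀ : ℕ} (h0 : ∑' n, coeff n f * (u ^ t₀ - 1) ^ n ≠ 0) :
    ∃ e : K, (1 + X) * (f * derivative K g - g * derivative K f) = C e * (f * g) := by
  have hpp := (Fact.out : p.Prime)
  -- the disc
  have hu1 : ‖u‖ = 1 := btn_norm_eq_one_of_oneUnit hu
  have hπ0 : u - 1 ≠ 0 := fun h ↦ hroot 1 one_pos (by rw [pow_one]; exact sub_eq_zero.1 h)
  have hρ0 : 0 < ‖u - 1‖ := norm_pos_iff.2 hπ0
  have hu0 : u ≠ 0 := fun h ↦ by rw [h, norm_zero] at hu1; exact zero_ne_one hu1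
  have hut : ∀ t : ℕ, u ^ t ≠ 0 := fun t ↦ pow_ne_zero t hu0
  -- nodes, values, increments
  set y : ℕ → K := fun t ↦ u ^ t - 1 with hy
  have hyρ : ∀ t, ‖y t‖ ≤ ‖u - 1‖ := fun t ↦ btn_norm_pow_sub_one_le hu t
  set a : ℕ → K := fun t ↦ ∑' n, coeff n f * y t ^ n with ha
  set b : ℕ → K := fun t ↦ ∑' n, coeff n g * y t ^ n with hb
  set A : ℕ → K := fun t ↦ ∑' n, coeff n (derivative K f) * y t ^ n with hA
  set B : ℕ → K := fun t ↦ ∑' n, coeff n (derivative K g) * y t ^ n with hB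
  set ε : ℕ → K := fun k ↦ u ^ p ^ k - 1 with hε
  set η : ℕ → K := fun k ↦ d ^ p ^ k - 1 with hη
  have hrel' : ∀ t, b t = c * d ^ t * a t := hrel
  have h0' : a t₀ ≠ 0 := h0
  have hεne : ∀ k, ε k ≠ 0 := fun k h ↦ hroot (p ^ k) (pow_pos hpp.pos k) (sub_eq_zero.1 h)
  have hε0 : Tendsto ε atTop (𝓝 0) := tendsto_pow_prime_pow_sub_one (p := p) hu
  have hshift : ∀ t k, y (t + p ^ k) = y t + u ^ t * ε k := by
    intro t k; simp only [hy, hε, pow_add]; ring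
  have hhne : ∀ t k, u ^ t * ε k ≠ 0 := fun t k ↦ mul_ne_zero (hut t) (hεne k)
  have hhnorm : ∀ t k, ‖u ^ t * ε k‖ = ‖ε k‖ := by
    intro t k; rw [norm_mul, norm_pow, hu1, one_pow, one_mul]
  have hh0 : ∀ t, Tendsto (fun k ↦ u ^ t * ε k) atTop (𝓝 0) := fun t ↦ by
    simpa using hε0.const_mul (u ^ t)
  -- difference quotients along `t ↦ t + p^k` tend to the derivative (Robert V.2.4 Theorem 1)
  have hslope : ∀ (F : K⟦X⟧), (∀ n, ‖coeff n F‖ ≤ 1) → ∀ t,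
      Tendsto (fun k ↦ (u ^ t * ε k)⁻¹ *
        (∑' n, coeff n F * y (t + p ^ k) ^ n - ∑' n, coeff n F * y t ^ n))
        atTop (𝓝 (∑' n, coeff n (derivative K F) * y t ^ n)) := by
    intro F hF t
    rw [tendsto_iff_norm_sub_tendsto_zero]
    refine squeeze_zero (g := fun k ↦ ‖u ^ t * ε k‖ / ‖u - 1‖ ^ 2) (fun _ ↦ norm_nonneg _)
      (fun k ↦ ?_) ?_
    · rw [hshift t k]
      have hyh : ‖y t + u ^ t * ε k‖ ≤ ‖u - 1‖ := by rw [← hshift]; exact hyρ _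
      exact norm_slope_sub_derivative_le_of_norm_coeff_le_one hF hπ0 hu (hyρ t) hyh (hhne t k)
    · have h1 := ((hh0 t).norm).div_const (‖u - 1‖ ^ 2)
      rw [norm_zero, zero_div] at h1
      exact h1
  -- the exact identity along the nodes
  have hQ : ∀ t k, a t * ((u ^ t * ε k)⁻¹ * (b (t + p ^ k) - b t)) -
      b t * ((u ^ t * ε k)⁻¹ * (a (t + p ^ k) - a t)) =
      η k / (u ^ t * ε k) * (b t * a (t + p ^ k)) := by
    intro t k
    have hne := hhne t k
    rw [hrel' t, hrel' (t + p ^ k), pow_add]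
    field_simp
    ring
  -- continuity of the values along `t + p^k`
  have hacont : ∀ t, Tendsto (fun k ↦ a (t + p ^ k)) atTop (𝓝 (a t)) := by
    intro t
    have h1 : ∀ k, a t + (u ^ t * ε k) * ((u ^ t * ε k)⁻¹ * (a (t + p ^ k) - a t)) = a (t + p ^ k) := by
      intro k; rw [← mul_assoc, mul_inv_cancel₀ (hhne t k), one_mul]; ring
    have h2 := ((hh0 t).mul (hslope f hf t)).const_add (a t)
    rw [zero_mul, add_zero] at h2
    exact h2.congr h1
  -- at `t₀` the denominator does not vanish: the quotient `η_k/(u^{t₀}ε_k)` converges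
  have hb0 : b t₀ ≠ 0 := by
    rw [hrel' t₀]; exact mul_ne_zero (mul_ne_zero hc (pow_ne_zero _ hd)) h0'
  have hD : Tendsto (fun k ↦ b t₀ * a (t₀ + p ^ k)) atTop (𝓝 (b t₀ * a t₀)) :=
    (hacont t₀).const_mul (b t₀)
  have hDne : b t₀ * a t₀ ≠ 0 := mul_ne_zero hb0 h0'
  have hN : Tendsto (fun k ↦ a t₀ * ((u ^ t₀ * ε k)⁻¹ * (b (t₀ + p ^ k) - b t₀)) -
      b t₀ * ((u ^ t₀ * ε k)⁻¹ * (a (t₀ + p ^ k) - a t₀))) atTop (𝓝 (a t₀ * B t₀ - b t₀ * A t₀)) :=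
    ((hslope g hg t₀).const_mul (a t₀)).sub ((hslope f hf t₀).const_mul (b t₀))
  set L : K := (a t₀ * B t₀ - b t₀ * A t₀) / (b t₀ * a t₀) with hL
  have hr : Tendsto (fun k ↦ η k / (u ^ t₀ * ε k)) atTop (𝓝 L) := by
    have hev : ∀ᶠ k in atTop, b t₀ * a (t₀ + p ^ k) ≠ 0 := hD.eventually_ne hDne
    have heq : (fun k ↦ (a t₀ * ((u ^ t₀ * ε k)⁻¹ * (b (t₀ + p ^ k) - b t₀)) -
        b t₀ * ((u ^ t₀ * ε k)⁻¹ * (a (t₀ + p ^ k) - a t₀))) / (b t₀ * a (t₀ + p ^ k))) =ᶠ[atTop]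
        fun k ↦ η k / (u ^ t₀ * ε k) := by
      filter_upwards [hev] with k hk
      rw [hQ t₀ k, mul_div_cancel_right₀ _ hk]
    exact (hN.div hD hDne).congr' heq
  -- the exponent
  set e : K := u ^ t₀ * L with he
  have hηε : Tendsto (fun k ↦ η k / ε k) atTop (𝓝 e) := by
    have h1 : ∀ k, u ^ t₀ * (η k / (u ^ t₀ * ε k)) = η k / ε k := by
      intro k; have := hεne k; have := hut t₀; field_simp
    exact (hr.const_mul (u ^ t₀)).congr h1
  refine ⟨e, ?_⟩
  -- the pointwise identity at every node
  have hpt : ∀ t, (1 + y t) * (a t * B t - b t * A t) = e * (a t * b t) := by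
    intro t
    have hlhs : Tendsto (fun k ↦ a t * ((u ^ t * ε k)⁻¹ * (b (t + p ^ k) - b t)) -
        b t * ((u ^ t * ε k)⁻¹ * (a (t + p ^ k) - a t))) atTop (𝓝 (a t * B t - b t * A t)) :=
      ((hslope g hg t).const_mul (a t)).sub ((hslope f hf t).const_mul (b t))
    have hrhs : Tendsto (fun k ↦ η k / (u ^ t * ε k) * (b t * a (t + p ^ k))) atTop
        (𝓝 ((u ^ t)⁻¹ * e * (b t * a t))) := by
      have h1 : ∀ k, (u ^ t)⁻¹ * (η k / ε k) * (b t * a (t + p ^ k)) =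
          η k / (u ^ t * ε k) * (b t * a (t + p ^ k)) := by
        intro k; have := hεne k; have := hut t; field_simp
      exact (((hηε.const_mul ((u ^ t)⁻¹)).mul ((hacont t).const_mul (b t))).congr h1)
    have heq := tendsto_nhds_unique hlhs (hrhs.congr fun k ↦ (hQ t k).symm)
    have hu_t : 1 + y t = u ^ t := by simp only [hy]; ring
    rw [hu_t, heq]
    have := hut t
    field_simp
  -- the bounded series `W = (1+X)(fg′ − gf′) − e·fg` vanishes at all nodes
  set W : K⟦X⟧ := (1 + X) * (f * derivative K g - g * derivative K f) - C e * (f * g) with hW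
  have hDf := btn_bdd_derivative (p := p) hf
  have hDg := btn_bdd_derivative (p := p) hg
  have hfDg : ∀ n, ‖coeff n (f * derivative K g)‖ ≤ 1 := fun n ↦
    (btn_bdd_mul zero_le_one hf hDg n).trans (by rw [one_mul])
  have hgDf : ∀ n, ‖coeff n (g * derivative K f)‖ ≤ 1 := fun n ↦
    (btn_bdd_mul zero_le_one hg hDf n).trans (by rw [one_mul])
  have hfg : ∀ n, ‖coeff n (f * g)‖ ≤ 1 := fun n ↦
    (btn_bdd_mul zero_le_one hf hg n).trans (by rw [one_mul])
  have hinner : ∀ n, ‖coeff n (f * derivative K g - g * derivative K f)‖ ≤ 1 := fun n ↦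
    (btn_bdd_sub hfDg hgDf n).trans (by rw [max_self])
  have h1X : ∀ n, ‖coeff n ((1 + X) * (f * derivative K g - g * derivative K f))‖ ≤ 1 :=
    btn_bdd_one_add_X_mul hinner
  have hCe : ∀ n, ‖coeff n (C e * (f * g))‖ ≤ ‖e‖ * 1 := btn_bdd_C_mul hfg e
  have hWbd : ∀ n, ‖coeff n W‖ ≤ max 1 (‖e‖ * 1) := btn_bdd_sub h1X hCe
  -- evaluation of `W` at the nodes
  have hWval : ∀ t, ∑' n, coeff n W * y t ^ n = 0 := by
    intro t
    have hyt := hyρ t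
    have hres : ∀ {F : K⟦X⟧} {A : ℝ}, (∀ n, ‖coeff n F‖ ≤ A) → IsRestricted ‖u - 1‖ F :=
      fun hF ↦ isRestricted_of_norm_coeff_le hF hρ0.le hu
    have hs : ∀ {F : K⟦X⟧} {A : ℝ}, (∀ n, ‖coeff n F‖ ≤ A) → Summable fun n ↦ coeff n F * y t ^ n :=
      fun hF ↦ summable_coeff_mul_pow (hres hF) hyt
    have e1 : ∑' n, coeff n W * y t ^ n =
        ∑' n, coeff n ((1 + X) * (f * derivative K g - g * derivative K f)) * y t ^ n -
          ∑' n, coeff n (C e * (f * g)) * y t ^ n := by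
      rw [← (hs h1X).tsum_sub (hs hCe)]
      exact tsum_congr fun n ↦ by rw [hW, map_sub, sub_mul]
    have e2 : ∑' n, coeff n (f * derivative K g - g * derivative K f) * y t ^ n = a t * B t - b t * A t := by
      rw [← tsum_coeff_mul (hres hf) (hres hDg) hyt, ← tsum_coeff_mul (hres hg) (hres hDf) hyt,
        ← (hs hfDg).tsum_sub (hs hgDf)]
      exact tsum_congr fun n ↦ by rw [map_sub, sub_mul]
    rw [e1, btn_tsum_one_add_X_mul hinner hρ0.le hu hyt, e2, btn_tsum_C_mul,
      tsum_coeff_mul (hres hf) (hres hg) hyt, hpt t, sub_self]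
  -- Strassmann on the closed disc `‖x‖ ≤ ‖u − 1‖`
  have hW0 : W = 0 := by
    refine eq_zero_of_infinite_zeros_closedBall hWbd hρ0 hu
      (Set.infinite_range_of_injective (btn_nodes_injective hu hroot)) ?_ ?_
    · rintro x ⟨t, rfl⟩; exact hyρ t
    · rintro x ⟨t, rfl⟩; exact hWval t
  rw [hW] at hW0
  exact sub_eq_zero.1 hW0

end Main

end Literature.NumberTheory.LocalFields
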